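import Summits.Langlands.Langlands.Theses.OrdinaryPrimeTransport
import Literature.NumberTheory.Automorphic.KimShahidiFunctorialProductGL2GL3
import Literature.NumberTheory.Automorphic.GLnAdelicStructureProofs
import HarnessLib

/-!
NOTE (tree copy). This published copy is typed against the `Iff.rfl`-equal shared decl
`Summit.Langlands.Langlands.Theses.OrdinaryPrimeTransport.ReciprocityUpToIrreducibility` of item stmt-Langlands-14328
(the crux-write farm path cannot serve the `IrreducibilityBySelfDuality` Theses module); the seat's registered `Sketch.lean`
is identical with `Theses.IrreducibilityBySelfDuality.ReciprocityUpToIrreducibility` in the import and the three concluding types.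
-/

/-!
# SKELETON — line `RankinSelbergGL3GL3` for the crux `ReciprocityUpToIrreducibility`
# (item stmt-Langlands-14328; routes IrreducibilityBySelfDuality / OrdinaryPrimeTransport)
# forward generator G4 ladder-down, generation 25 (unit fwd2-ladder-Langlands-14328-g25)

Dial θ27 = the PAIR OF FACTOR RANKS `(m, n)` of the Rankin–Selberg / functorial tensor product
`⊠ : GL_m × GL_n → GL_{mn}` (the L-map `r_⊗`, Getz–Hahn (13.9)) inside clause (B) of the top
E = `ReciprocityUpToIrreducibility`, over EVERY number field `F`, with AUTOMORPHIC inputs: a pair of cuspidal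
`π₁` on `GL_m(𝔸_F)`, `π₂` on `GL_n(𝔸_F)` (no algebraicity, regularity, parity or field hypothesis — Maass ⊠ Maass
included) and an irreducible de Rham `ρ : Γ_F → GL_{mn}(ℚ̄_ℓ)` whose Frobenius characteristic polynomials are a.e.
the `ι`-Satake polynomials of `t_{π₁,v} ⊗ t_{π₂,v}` (`satakeTensor`).  The graded family
`RankinSelbergGaloisToAutomorphic m n` is clause (B) on that cell in the a.e.-Satake form; it follows from the
TEXT family `WeakTensorProductFunctoriality m n` ("`π₁ ⊠ π₂` is (weakly) automorphic", Ramakrishnan's *weak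
automorphic tensor product*) by `of_weakTensorProductFunctoriality`.  Decided cells: `(2,2)` = Ramakrishnan 2000
Theorem M (IN TREE as the named fact `Ramakrishnan2000_theoremM`; `floor_two_two`) and `(2,3)` = Kim–Shahidi 2002
Theorem A (= Thm 5.1; text `KimShahidi2002_functorialProduct_GL2GL3`, vendoring proposed; `floor_two_three`);
Getz–Hahn 2024 Thm 13.6.2 and Ramakrishnan (arXiv:0710.0676, (1.5.2)) print that these are ALL the known cells.
THE RUNG = the first open cell WITHOUT a `GL₂` factor: `(3,3)`, `GL₃ × GL₃ → GL₉` (`RankinSelbergGL3GL3`).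
Sector = ordered pairs `2 ≤ m ≤ n` (a `(n,m)`-presentation is an `(m,n)`-presentation by `satakeTensor_comm`;
`m = 1` is a twist and stays off-sector).

Located stop (why the floor's method does not climb): the converse theorem for `GL_N` needs the twisted
`L(s, (π₁ ⊠ π₂) × τ)` for cuspidal `τ` on `GL_r`, all `r ≤ N - 2` (Cogdell–Piatetski-Shapiro), and the only
source of the triple products `L(s, π₁ × π₂ × τ)` is the Langlands–Shahidi method on the maximal Levi
`GL_p × GL_q × GL_r` of the simply connected group with T-shaped diagram `T_{p,q,r}`, which is of finite type iff
`1/p + 1/q + 1/r > 1`: `(2,2,r)` = `D_{r+2}`, `(2,3,3)` = `E₆`, `(2,3,4)` = `E₇`, `(2,3,5)` = `E₈`.  For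
`(m,n) = (2,3)`, `N = 6`, twists `r ≤ 4` — exactly `D₅, E₆, E₇` (Kim–Shahidi pp. 849–852; Cogdell p. 253).  For
`(3,3)`, `N = 9` needs `r ≤ 7` but `1/3 + 1/3 + 1/r > 1` forces `r ≤ 2` (`E₆` only): the method stops, checkably.

Five registered stubs and the kernel-checked composition `ReciprocityUpToIrreducibility_of` concluding the crux BY
NAME (`Summit.Langlands.Langlands.Theses.OrdinaryPrimeTransport.ReciprocityUpToIrreducibility`; the tree copy
under `Cruxes/…/Lines/` concludes the `Iff.rfl`-equal shared decl of route OrdinaryPrimeTransport):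

* `stub_floorFacts : WeakTensorTexts` — the cells `(2,2)`, `(2,3)` as TEXTS in print (the in-tree named fact
  `Ramakrishnan2000_theoremM` verbatim; Kim–Shahidi 2002 Thm A as `WeakTensorProductFunctoriality 2 3`);
* `stub_rung : RankinSelbergGL3GL3` — THE RUNG (first open cell without a `GL₂` factor, `(3,3)`);
* `stub_higherRanks : HigherRanks` — the cells `2 ≤ m ≤ n`, `mn ≥ 8`, `(m,n) ≠ (3,3)` (open; NOTE: the cell
  `(2,4)` contains the core of line g5 `TensorGaloisToAutomorphicQ3` (`GL₂ × (GL₂ ⊠ GL₂)`), which is why the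
  rung is `(3,3)` and not `(2,4)`);
* `stub_sectorMerge : (∀ m n, 2 ≤ m → m ≤ n → family m n) → SectorGaloisToAutomorphic` — upgrade a.e.-Satake
  automorphy on the `⊠`-sector to clause (B) of E verbatim (cuspidal, L-algebraic, `Corresponds` at every place,
  every `Rec`);
* `stub_offSector : OffSectorReciprocity` — E with clause (B) restricted OFF the `⊠`-sector (honest complement).

Composition: `Rec` and clause (A) from `stub_offSector`; clause (B) by `by_cases InRSSector F ℓ ι ρ`.
Sorries ONLY inside the five `stub_*`.  Also recorded (sorry-free): `rankinSelbergGaloisToAutomorphic_of_top :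
E → family m n` and `…_of_langlands : Langlands → family m n` (every `m, n ≥ 1`), the F3 instances at the floor
cells and the floor decls `RankinSelbergGL2GL2`, `RankinSelbergGL2GL3`.
-/

noncomputable section

set_option linter.dupNamespace false

open scoped MatrixGroups Matrix NumberField Classical Polynomial
open Filter IsDedekindDomain Field Polynomial
open Literature.NumberTheory.Automorphic Literature.NumberTheory.GaloisRepresentations
open Literature.NumberTheory.PAdicHodge
open Summit.Langlands

namespace Summit.Langlands.Langlands.Cruxes.ReciprocityUpToIrreducibility.RankinSelbergGL3GL3

/-! ## 1. Weak tensor-product (Rankin–Selberg) lifts — IN TREE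
`IsTensorLiftAE`, `WeakTensorProductFunctoriality m n` and the named fact
`KimShahidi2002_functorialProduct_GL2GL3 := WeakTensorProductFunctoriality 2 3` (Kim–Shahidi 2002 Thm A) are the
Literature declarations of `Literature/NumberTheory/Automorphic/KimShahidiFunctorialProductGL2GL3.lean` (p203420,
vendored by this unit), used here BY NAME. -/

/-! ## 2. The graded family (dial = the pair of factor ranks `(m, n)`, target rank `m * n`) and the rung `(3,3)` -/

/-- **The rung family** `RankinSelbergGaloisToAutomorphic m n`: clause (B) of the summit (Galois ⇒ automorphic)
over EVERY number field `F`, at EVERY `ℓ` and `ι : ℚ̄_ℓ ≃ ℂ`, in the a.e.-Satake form, for irreducible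
`ρ : Γ_F → GL_{mn}(ℚ̄_ℓ)` de Rham above `ℓ` (pinned Fontaine datum `fontainePstAdicCompletion`) whose Frobenius
characteristic polynomials are, at all but finitely many places, the `ι`-Satake polynomials of `α_v ⊗ β_v` for the
Satake parameters `α_v`, `β_v` of a pair of CUSPIDAL `π₁` on `GL_m(𝔸_F)`, `π₂` on `GL_n(𝔸_F)` — the unramified
shadow of "`ρ ≅ ρ_{π₁} ⊗ ρ_{π₂}`", stated without assuming that `π₁`, `π₂` have Galois representations.
Conclusion: an AUTOMORPHIC `P` on `GL_{mn}(𝔸_F)` (Borel–Jacquet datum, not asserted cuspidal) with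
`SatakeFrobCompatibleAt ι P ρ v` for almost all `v`.  Implied by the summit and by E for every `m, n ≥ 1`
(`…_of_langlands`, `…_of_top`); implied by `WeakTensorProductFunctoriality m n`
(`of_weakTensorProductFunctoriality`), hence PROVED at `(2,2)` modulo the in-tree named fact and at `(2,3)` modulo
Kim–Shahidi Thm A; OPEN at `(3,3)` (`GL₃ × GL₃ → GL₉`). -/
def RankinSelbergGaloisToAutomorphic (m n : ℕ) : Prop :=
  ∀ (F : Type) [Field F] [NumberField F]
    (hm : Literature.NumberTheory.Automorphic.isCompact_glFiniteIntegralLevel m F)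
    (hn : Literature.NumberTheory.Automorphic.isCompact_glFiniteIntegralLevel n F)
    (π₁ : Literature.NumberTheory.Automorphic.CuspidalAutomorphicRepData m F hm)
    (π₂ : Literature.NumberTheory.Automorphic.CuspidalAutomorphicRepData n F hn)
    (ℓ : ℕ) [Fact ℓ.Prime] (ι : PadicAlgCl ℓ ≃+* ℂ)
    (ρ : Literature.NumberTheory.GaloisRepresentations.FramedGaloisRep F (PadicAlgCl ℓ) (m * n)),
    ρ.toGaloisRep.IsIrreducible →
    (∀ (v : IsDedekindDomain.HeightOneSpectrum (NumberField.RingOfIntegers F))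
      (hv : ((ℓ : ℕ) : NumberField.RingOfIntegers F) ∈ v.asIdeal),
      (Literature.NumberTheory.PAdicHodge.fontainePstAdicCompletion v ℓ hv).IsDeRhamFramed (ρ.toLocal v)) →
    (∀ᶠ v : IsDedekindDomain.HeightOneSpectrum (NumberField.RingOfIntegers F) in Filter.cofinite,
      ∃ α β : Multiset ℂ, π₁.1.HasSatakeParamAt v α ∧ π₂.1.HasSatakeParamAt v β ∧ ρ.IsUnramifiedAt v ∧
        ρ.HasFrobCharpolyAt v
          (Literature.NumberTheory.Automorphic.arithFrobPolyOfSatake ι v.residueCard 1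
            (Literature.NumberTheory.Automorphic.satakeTensor α β))) →
    ∀ hcpt : Literature.NumberTheory.Automorphic.isCompact_glFiniteIntegralLevel (m * n) F,
      ∃ P : Literature.NumberTheory.Automorphic.AutomorphicRepData
          (Literature.NumberTheory.Automorphic.AutomorphyDatum.gl (m * n) F hcpt),
        ∀ᶠ v : IsDedekindDomain.HeightOneSpectrum (NumberField.RingOfIntegers F) in Filter.cofinite,
          Summit.Langlands.SatakeFrobCompatibleAt ι P ρ v

/-- **THE RUNG** (the filed statement): the family at `(m, n) = (3, 3)` — clause (B) for irreducible de Rham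
`GL₉`-representations of `GL₃ ⊠ GL₃` type over every number field. -/
def RankinSelbergGL3GL3 : Prop := RankinSelbergGaloisToAutomorphic 3 3

/-- The floor cell `(2,2)` of the family as a decl (decided modulo the in-tree named fact, `floor_two_two`). -/
def RankinSelbergGL2GL2 : Prop := RankinSelbergGaloisToAutomorphic 2 2

/-- The floor cell `(2,3)` of the family as a decl (decided modulo Kim–Shahidi Thm A, `floor_two_three`). -/
def RankinSelbergGL2GL3 : Prop := RankinSelbergGaloisToAutomorphic 2 3

/-! ## 3. Weak functoriality at `(m,n)` gives the rung family at `(m,n)` -/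

/-- **`WeakTensorProductFunctoriality m n → RankinSelbergGaloisToAutomorphic m n`**: the automorphic a.e. tensor
lift `P` of `(π₁, π₂)` has, at almost every `v`, the Satake parameter `α_v ⊗ β_v`, which is what the sector clause
says `ρ(Frob_v)` has as inverse-root data. [folklore] -/
theorem of_weakTensorProductFunctoriality {m n : ℕ} (h : WeakTensorProductFunctoriality m n) :
    RankinSelbergGaloisToAutomorphic m n := by
  intro F _ _ hm hn π₁ π₂ ℓ _ ι ρ _hirr _hdR hsec hcpt
  obtain ⟨P, hP⟩ := h F hm hn hcpt π₁ π₂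
  refine ⟨P, ?_⟩
  have hP' : ∀ᶠ v : HeightOneSpectrum (𝓞 F) in cofinite, ∀ α β : Multiset ℂ,
      π₁.1.HasSatakeParamAt v α → π₂.1.HasSatakeParamAt v β → P.HasSatakeParamAt v (satakeTensor α β) := hP
  filter_upwards [hsec, hP'] with v hv hPv
  obtain ⟨α, β, hπ₁, hπ₂, hur, hcp⟩ := hv
  exact ⟨satakeTensor α β, hPv α β hπ₁ hπ₂, hur, hcp⟩

/-! ## 4. The floor cells `(2,2)` (Ramakrishnan 2000 Thm M, IN TREE as a named fact) and `(2,3)` (Kim–Shahidi) -/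

/-- **Ramakrishnan's Theorem M gives weak tensor functoriality at `(2,2)`** (target rank `2 * 2 = 4` by `rfl`;
clause (i) of the in-tree named fact verbatim; the two level-`2` compactness witnesses are proofs of one
proposition). [cite: Ramakrishnan2000, Theorem M (§3)] -/
theorem weakTensorProductFunctoriality_two_two (h : Ramakrishnan2000_theoremM) :
    WeakTensorProductFunctoriality 2 2 :=
  weakTensorProductFunctoriality_two_two_of_theoremM h

/-- **THE FLOOR `(2,2)` (PROVED modulo the in-tree named fact)**: clause (B) for irreducible de Rham
`ρ : Γ_F → GL₄(ℚ̄_ℓ)` of `GL₂ ⊠ GL₂` type, over every number field. [cite: Ramakrishnan2000, Theorem M] -/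
theorem floor_two_two (h : Ramakrishnan2000_theoremM) : RankinSelbergGaloisToAutomorphic 2 2 :=
  of_weakTensorProductFunctoriality (weakTensorProductFunctoriality_two_two h)

/-- **THE FLOOR `(2,3)` (PROVED modulo Kim–Shahidi 2002 Thm A as a text)**: clause (B) for irreducible de Rham
`ρ : Γ_F → GL₆(ℚ̄_ℓ)` of `GL₂ ⊠ GL₃` type, over every number field — THE WITNESS one step below the rung.
[cite: KimShahidi2002, Theorem A] -/
theorem floor_two_three (h : KimShahidi2002_functorialProduct_GL2GL3) : RankinSelbergGaloisToAutomorphic 2 3 :=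
  of_weakTensorProductFunctoriality h

/-- F3 special-case instance at the floor cell `(2,2)`. -/
example (h : Ramakrishnan2000_theoremM) : RankinSelbergGL2GL2 := floor_two_two h

/-- F3 special-case instance at the floor cell `(2,3)`. -/
example (h : KimShahidi2002_functorialProduct_GL2GL3) : RankinSelbergGL2GL3 := floor_two_three h

/-! ## 5. The sector, its merge target and the off-sector complement -/

/-- **The `⊠`-sector of clause (B)**: `ρ : Γ_F → GL_N(ℚ̄_ℓ)` is of Rankin–Selberg type — `N = m n` for some
`2 ≤ m ≤ n` and there are cuspidal `π₁` on `GL_m(𝔸_F)`, `π₂` on `GL_n(𝔸_F)` such that, at almost every place,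
`ρ` is unramified with Frobenius characteristic polynomial the `ι`-Satake polynomial of `t_{π₁,v} ⊗ t_{π₂,v}`.
(Ordered pairs: an `(n,m)`-presentation gives an `(m,n)`-presentation by `satakeTensor_comm`.) -/
def InRSSector (F : Type) [Field F] [NumberField F] (ℓ : ℕ) [Fact ℓ.Prime] (ι : PadicAlgCl ℓ ≃+* ℂ)
    {N : ℕ} (ρ : FramedGaloisRep F (PadicAlgCl ℓ) N) : Prop :=
  ∃ m n : ℕ, 2 ≤ m ∧ m ≤ n ∧ N = m * n ∧
    ∃ (hm : isCompact_glFiniteIntegralLevel m F) (hn : isCompact_glFiniteIntegralLevel n F)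
      (π₁ : CuspidalAutomorphicRepData m F hm) (π₂ : CuspidalAutomorphicRepData n F hn),
      ∀ᶠ v : HeightOneSpectrum (𝓞 F) in cofinite,
        ∃ α β : Multiset ℂ, π₁.1.HasSatakeParamAt v α ∧ π₂.1.HasSatakeParamAt v β ∧ ρ.IsUnramifiedAt v ∧
          ρ.HasFrobCharpolyAt v (arithFrobPolyOfSatake ι v.residueCard 1 (satakeTensor α β))

/-- **Merge target**: clause (B) of E VERBATIM (cuspidal, L-algebraic, `Corresponds Rec ι π ρ` — a.e. Satake AND
`LocalGlobalCompatibleAt` at every finite place) for EVERY reciprocity datum `Rec`, on the `⊠`-sector. -/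
def SectorGaloisToAutomorphic : Prop :=
  ∀ (F : Type) [Field F] [NumberField F] (Rec : ReciprocityData F) (N : ℕ), 0 < N →
    ∀ (hcpt : isCompact_glFiniteIntegralLevel N F) (ℓ : ℕ) [Fact ℓ.Prime] (ι : PadicAlgCl ℓ ≃+* ℂ)
      (ρ : FramedGaloisRep F (PadicAlgCl ℓ) N),
      ρ.toGaloisRep.IsIrreducible → IsGeometricFramed Rec ρ → InRSSector F ℓ ι ρ →
        ∃ π : CuspidalAutomorphicRepData N F hcpt, π.1.IsLAlgebraic ∧ Corresponds Rec ι π.1 ρ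

/-- **The off-sector complement**: E (`ReciprocityUpToIrreducibility`) with clause (A) entire and clause (B)
restricted to `ρ` NOT in the `⊠`-sector. -/
def OffSectorReciprocity : Prop :=
  ∀ (F : Type) [Field F] [NumberField F], ∃ Rec : ReciprocityData F, ∀ N : ℕ, 0 < N →
    ∀ hcpt : isCompact_glFiniteIntegralLevel N F,
      (∀ π : CuspidalAutomorphicRepData N F hcpt, π.1.IsLAlgebraic →
        ∀ (ℓ : ℕ) [Fact ℓ.Prime] (ι : PadicAlgCl ℓ ≃+* ℂ),
          ∃ ρ : FramedGaloisRep F (PadicAlgCl ℓ) N, IsGeometricFramed Rec ρ ∧ Corresponds Rec ι π.1 ρ) ∧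
      (∀ (ℓ : ℕ) [Fact ℓ.Prime] (ι : PadicAlgCl ℓ ≃+* ℂ) (ρ : FramedGaloisRep F (PadicAlgCl ℓ) N),
        ρ.toGaloisRep.IsIrreducible → IsGeometricFramed Rec ρ → ¬ InRSSector F ℓ ι ρ →
          ∃ π : CuspidalAutomorphicRepData N F hcpt, π.1.IsLAlgebraic ∧ Corresponds Rec ι π.1 ρ)

/-- **The floor cells as texts**: Ramakrishnan 2000 Thm M at `(2,2)` (the in-tree named fact verbatim) and
Kim–Shahidi 2002 Thm A at `(2,3)`. [cite: Ramakrishnan2000, Theorem M] [cite: KimShahidi2002, Theorem A] -/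
def WeakTensorTexts : Prop :=
  Ramakrishnan2000_theoremM ∧ KimShahidi2002_functorialProduct_GL2GL3

/-- **The higher rungs** of the graded family: ordered cells `2 ≤ m ≤ n` of rank `mn ≥ 8` other than the rung
`(3,3)` — `(2,4), (2,5), …, (3,4), (4,4), …` (all open; `(2,4)` contains the core of line g5). -/
def HigherRanks : Prop :=
  ∀ m n : ℕ, 2 ≤ m → m ≤ n → 8 ≤ m * n → (m, n) ≠ (3, 3) → RankinSelbergGaloisToAutomorphic m n

/-! ## 6. The five registered stubs -/

/-- Floor cells `(2,2)`, `(2,3)` — theorems in print (Ramakrishnan 2000 Thm M; Kim–Shahidi 2002 Thm A).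
[cite: Ramakrishnan2000, Theorem M] [cite: KimShahidi2002, Theorem A] -/
theorem stub_floorFacts : WeakTensorTexts := by
  sorry

/-- **THE RUNG** `(3,3)`: clause (B), a.e.-Satake form, for irreducible de Rham `ρ : Γ_F → GL₉(ℚ̄_ℓ)` of
`GL₃ ⊠ GL₃`-type over every number field.  OPEN (Langlands–Shahidi + converse theorem stop at `(2,3)`: the
`GL₉` converse theorem needs twists by `GL_r`, `r ≤ 7`; triple products `GL₃ × GL₃ × GL_r` exist only for
`r ≤ 2`, Levi of `E₆`). -/
theorem stub_rung : RankinSelbergGL3GL3 := by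
  sorry

/-- The cells `2 ≤ m ≤ n`, `mn ≥ 8`, `(m,n) ≠ (3,3)` of the family (open). -/
theorem stub_higherRanks : HigherRanks := by
  sorry

/-- Sector merge: from a.e.-Satake automorphy on the whole `⊠`-sector (all `2 ≤ m ≤ n`) to clause (B) of E
verbatim on the sector, for every `Rec` (isobaric rigidity ⇒ cuspidal — `ρ` is irreducible; L-algebraicity;
local–global compatibility at every finite place, the `v ∣ ℓ` clause against the pinned Fontaine datum). -/
theorem stub_sectorMerge :
    (∀ m n : ℕ, 2 ≤ m → m ≤ n → RankinSelbergGaloisToAutomorphic m n) → SectorGaloisToAutomorphic := by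
  sorry

/-- The honest complement: E off the `⊠`-sector. -/
theorem stub_offSector : OffSectorReciprocity := by
  sorry

/-! ## 7. Composition (no sorry below this line) -/

/-- The whole graded family (ordered cells `2 ≤ m ≤ n`) from the floor texts, the rung and the higher rungs:
`mn ≤ 7` with `2 ≤ m ≤ n` forces `(m,n) ∈ {(2,2), (2,3)}`. -/
theorem family_of (hT : WeakTensorTexts) (h33 : RankinSelbergGL3GL3) (hhi : HigherRanks)
    (m n : ℕ) (hm : 2 ≤ m) (hmn : m ≤ n) : RankinSelbergGaloisToAutomorphic m n := by
  obtain ⟨h22, h23⟩ := hT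
  by_cases h8 : 8 ≤ m * n
  · by_cases h3 : (m, n) = (3, 3)
    · simp only [Prod.mk.injEq] at h3
      obtain ⟨rfl, rfl⟩ := h3
      exact h33
    · exact hhi m n hm hmn h8 h3
  · have hmm : m * m ≤ m * n := Nat.mul_le_mul_left m hmn
    have hm2 : m ≤ 2 := by nlinarith
    obtain rfl : m = 2 := le_antisymm hm2 hm
    have hn3 : n ≤ 3 := by omega
    interval_cases n
    · exact floor_two_two h22
    · exact floor_two_three h23

/-- **COMPOSITION — the crux BY NAME from the five stub statements.**  `Rec` and clause (A) come from the
off-sector statement; clause (B) is a case split on the `⊠`-sector. -/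
theorem ReciprocityUpToIrreducibility_of :
    WeakTensorTexts → RankinSelbergGL3GL3 → HigherRanks →
    ((∀ m n : ℕ, 2 ≤ m → m ≤ n → RankinSelbergGaloisToAutomorphic m n) → SectorGaloisToAutomorphic) →
    OffSectorReciprocity →
    Summit.Langlands.Langlands.Theses.OrdinaryPrimeTransport.ReciprocityUpToIrreducibility := by
  intro hT h33 hhi hmerge hoff F _ _
  obtain ⟨Rec, hall⟩ := hoff F
  refine ⟨Rec, fun N hN hcpt => ⟨(hall N hN hcpt).1, ?_⟩⟩
  intro ℓ _ ι ρ hirr hgeo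
  by_cases hsec : InRSSector F ℓ ι ρ
  · exact hmerge (family_of hT h33 hhi) F Rec N hN hcpt ℓ ι ρ hirr hgeo hsec
  · exact (hall N hN hcpt).2 ℓ ι ρ hirr hgeo hsec

/-- The crux from the REGISTERED stubs (audit: proof-of-item modulo the five sorries). -/
theorem reciprocityUpToIrreducibility_of_stubs :
    Summit.Langlands.Langlands.Theses.OrdinaryPrimeTransport.ReciprocityUpToIrreducibility :=
  ReciprocityUpToIrreducibility_of stub_floorFacts stub_rung stub_higherRanks stub_sectorMerge stub_offSector

/-! ## 8. The rung is a consequence of the top and of the summit (sorry-free) -/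

/-- `E → RankinSelbergGaloisToAutomorphic m n` for every `m, n ≥ 1` (clause (B) of E for its own `Rec`: the
family's de Rham clause is against `fontainePstAdicCompletion = Rec.pst` by `rfl`, a.e. unramifiedness is read off
the sector clause, cuspidal ⇒ automorphic, `Corresponds` ⊃ a.e. Satake). -/
theorem rankinSelbergGaloisToAutomorphic_of_top (m n : ℕ) (hm : 1 ≤ m) (hn : 1 ≤ n)
    (hE : Summit.Langlands.Langlands.Theses.OrdinaryPrimeTransport.ReciprocityUpToIrreducibility) :
    RankinSelbergGaloisToAutomorphic m n := by
  intro F _ _ hmF hnF π₁ π₂ ℓ _ ι ρ hirr hdR hsec hcpt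
  obtain ⟨Rec, hall⟩ := hE F
  have hpos : 0 < m * n := Nat.mul_pos hm hn
  have hB : GaloisToAutomorphic (m * n) Rec hcpt := (hall (m * n) hpos hcpt).2
  have hgeo : IsGeometricFramed Rec ρ :=
    ⟨hsec.mono fun v ⟨_, _, _, _, hur, _⟩ => hur, fun v hv => hdR v hv⟩
  obtain ⟨π', -, hcorr⟩ := hB ℓ ι ρ hirr hgeo
  exact ⟨π'.1, hcorr.1⟩

/-- `E → rung`. -/
theorem RankinSelbergGL3GL3_of_top
    (hE : Summit.Langlands.Langlands.Theses.OrdinaryPrimeTransport.ReciprocityUpToIrreducibility) :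
    RankinSelbergGL3GL3 :=
  rankinSelbergGaloisToAutomorphic_of_top 3 3 (by norm_num) (by norm_num) hE

/-- **Dial monotonicity in the summit direction**: `Langlands → RankinSelbergGaloisToAutomorphic m n` for every
`m, n ≥ 1` — clause (B) at rank `mn` over `F` for the reciprocity datum the summit provides. -/
theorem rankinSelbergGaloisToAutomorphic_of_langlands (m n : ℕ) (hm : 1 ≤ m) (hn : 1 ≤ n)
    (hL : _root_.Langlands) : RankinSelbergGaloisToAutomorphic m n := by
  intro F _ _ hmF hnF π₁ π₂ ℓ _ ι ρ hirr hdR hsec hcpt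
  obtain ⟨⟨Rec⟩, hall⟩ := hL F
  have hpos : 0 < m * n := Nat.mul_pos hm hn
  have hB : GaloisToAutomorphic (m * n) Rec hcpt := (hall Rec (m * n) hpos hcpt).2
  have hgeo : IsGeometricFramed Rec ρ :=
    ⟨hsec.mono fun v ⟨_, _, _, _, hur, _⟩ => hur, fun v hv => hdR v hv⟩
  obtain ⟨π', -, hcorr⟩ := hB ℓ ι ρ hirr hgeo
  exact ⟨π'.1, hcorr.1⟩

/-- **F4 on-path lemma for the rung**: `Langlands → RankinSelbergGL3GL3`. -/
@[aesop safe apply]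
theorem RankinSelbergGL3GL3_of_Langlands (hL : _root_.Langlands) : RankinSelbergGL3GL3 :=
  rankinSelbergGaloisToAutomorphic_of_langlands 3 3 (by norm_num) (by norm_num) hL

end Summit.Langlands.Langlands.Cruxes.ReciprocityUpToIrreducibility.RankinSelbergGL3GL3

end
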